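import Mathlib
import Summits.Ventures.HodgeRepro.Tier4.Target

/-!
# Tier4/Line3/WittRank3 — L3.b: Witt's theorem for rank-3 quadruples in an anisotropic hermitian 3-space

Blind re-derivation cell `pub-hodge-repro`, Tier 4 «PROVE THE STEP» (README §9–§10), LINE L3 (orbit expansion of the
quadruple theta period; skeleton `Tier4/Line3/Skeleton.lean` v0.5, sha256 ff05083c…, L434–L440), seat t4-L3-p1
(prover), assigned by the lead (STATUS S12017).

THE LEMMA (L3.b of the line, «cut for provers»): two quadruples `x, x' : Fin 4 → Fin 3 → E` of vectors of the hermitian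
space `V = E³` (form `⟨u, v⟩_H = c(u)ᵀ H v` = `hform c H u v` of `Tier4/Target.lean`, `H` anisotropic) whose first three
vectors are bases of `E³` and whose Gram matrices `(⟨x_i, x_j⟩_H)_{i,j}` agree lie in one `U(H)(E)`-orbit: there is
`g` with `c(g)ᵀ H g = H` (`IsUnitaryOf c H g`) and `x'_j = g x_j` for all four `j`.

PRINTED FORM (t4-lit-6, INPUTS row I-t4-lit-6-20): Mœglin–Vignéras–Waldspurger, *Correspondances de Howe sur un corps
p-adique*, LNM 1291 (1987), chap. 1 §I.9 «Théorème de Witt» and §II.3 «Lemmes géométriques» (tuples with the same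
Gram matrix spanning subspaces of the same dimension lie in one `U`-orbit).  The special case proved here (the tuple
spans the whole space, `dim V = 3`) needs no extension step, so the proof below is self-contained linear algebra
and assumes NO literature fact:

* `B`, `B'` := the `3×3` matrices with columns `x₀, x₁, x₂` resp. `x'₀, x'₁, x'₂` — units, by the linear independence
  (`Matrix.linearIndependent_cols_iff_isUnit`); `g := B' B⁻¹`, so `g x_j = x'_j` for `j < 3`.
* Unitarity: the `3×3` Gram blocks are `c(B)ᵀ H B` and `c(B')ᵀ H B'` (`cstar_mul_mul_apply`); they agree, so
  `c(g)ᵀ H g = c(B⁻¹)ᵀ (c(B')ᵀ H B') B⁻¹ = c(B⁻¹)ᵀ (c(B)ᵀ H B) B⁻¹ = c(B B⁻¹)ᵀ H (B B⁻¹) = H`.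
* The fourth vector: with `a := B⁻¹ x₃` and `a' := B'⁻¹ x'₃` (so `x₃ = B a`, `x'₃ = B' a'`) the Gram columns give
  `G a = (⟨x_i, x₃⟩)_i = (⟨x'_i, x'₃⟩)_i = G a'` for the Gram block `G = c(B)ᵀ H B`, which is a unit because `H` is
  (anisotropy makes `v ↦ H v` injective, `isUnit_of_anisotropic`); hence `a = a'` and `g x₃ = B' B⁻¹ B a = B' a' = x'₃`.

Module contract: imports Mathlib and `Tier4/Target.lean` only (by name); every declaration carries a docstring;
`#print axioms witt_rank3_of_gram_eq` = `[propext, Classical.choice, Quot.sound]`.  Nothing here asserts anything about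
the truth of (P); HC_CM is NOT proved by anyone in this repository.
-/

set_option autoImplicit false

noncomputable section

namespace Summit.Ventures.HodgeRepro.Tier4.Line3

open Matrix

section WittRank3

variable {E : Type*} [Field E] (c : E ≃+* E) (H : Matrix (Fin 3) (Fin 3) E)

/-- Entries of the conjugate transpose: `(c(A)ᵀ)_{ij} = c(A_{ji})`. -/
theorem cstar_apply (A : Matrix (Fin 3) (Fin 3) E) (i j : Fin 3) : cstar c A i j = c (A j i) := rfl

/-- The conjugate transpose reverses products: `c(AB)ᵀ = c(B)ᵀ c(A)ᵀ`. -/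
theorem cstar_mul (A B : Matrix (Fin 3) (Fin 3) E) : cstar c (A * B) = cstar c B * cstar c A := by
  unfold cstar
  rw [Matrix.map_mul, Matrix.transpose_mul]

/-- The conjugate transpose of the identity is the identity. -/
theorem cstar_one : cstar c (1 : Matrix (Fin 3) (Fin 3) E) = 1 := by
  unfold cstar
  rw [Matrix.map_one (⇑c) (map_zero c) (map_one c), Matrix.transpose_one]

/-- The `i`-th coordinate of `c(B)ᵀ H v` is the hermitian pairing of the `i`-th column of `B` with `v`. -/
theorem cstar_mul_mulVec_apply (B : Matrix (Fin 3) (Fin 3) E) (v : Fin 3 → E) (i : Fin 3) :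
    ((cstar c B * H) *ᵥ v) i = hform c H (fun k => B k i) v := by
  rw [← Matrix.mulVec_mulVec]
  simp only [Matrix.mulVec, dotProduct, cstar, hform, Matrix.transpose_apply, Matrix.map_apply]

/-- The Gram block: `(c(B)ᵀ H B)_{ij} = ⟨B_{·i}, B_{·j}⟩_H`. -/
theorem cstar_mul_mul_apply (B : Matrix (Fin 3) (Fin 3) E) (i j : Fin 3) :
    (cstar c B * H * B) i j = hform c H (fun k => B k i) (fun k => B k j) := by
  rw [← cstar_mul_mulVec_apply]
  rfl

/-- An anisotropic hermitian matrix is invertible: `H v = 0` forces `⟨v, v⟩_H = 0`, hence `v = 0`. -/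
theorem isUnit_of_anisotropic (hAn : Anisotropic c H) : IsUnit H := by
  rw [← Matrix.mulVec_injective_iff_isUnit]
  intro v w hvw
  have h0 : H *ᵥ (v - w) = 0 := by
    rw [Matrix.mulVec_sub, hvw, sub_self]
  have h1 : hform c H (v - w) (v - w) = 0 := by
    unfold hform
    rw [h0, dotProduct_zero]
  exact sub_eq_zero.mp (hAn _ h1)

/-- The conjugate transpose of a unit is a unit (`det c(B)ᵀ = c(det B)`). -/
theorem isUnit_cstar {B : Matrix (Fin 3) (Fin 3) E} (hB : IsUnit B) : IsUnit (cstar c B) := by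
  unfold cstar
  rw [Matrix.isUnit_transpose, Matrix.isUnit_iff_isUnit_det]
  have hdet : (B.map c).det = c B.det := by
    rw [RingEquiv.map_det c B]
    rfl
  rw [hdet]
  exact ((Matrix.isUnit_iff_isUnit_det B).mp hB).map c

/-- **L3.b, WITT FOR RANK-3 QUADRUPLES** (pointwise Gram hypothesis): if the first three vectors of `x` and of `x'` are
bases of `E³` and `⟨x_i, x_j⟩_H = ⟨x'_i, x'_j⟩_H` for all `i, j : Fin 4`, then some `g ∈ U(H)` carries `x` to `x'`. -/
theorem witt_rank3_of_gram (hAn : Anisotropic c H) (x x' : Fin 4 → Fin 3 → E)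
    (hx : LinearIndependent E (fun j : Fin 3 => x (Fin.castSucc j)))
    (hx' : LinearIndependent E (fun j : Fin 3 => x' (Fin.castSucc j)))
    (hG : ∀ i j, hform c H (x i) (x j) = hform c H (x' i) (x' j)) :
    ∃ g : Matrix (Fin 3) (Fin 3) E, IsUnitaryOf c H g ∧ ∀ j, x' j = g *ᵥ x j := by
  -- the matrices with columns `x₀, x₁, x₂` and `x'₀, x'₁, x'₂`
  set B : Matrix (Fin 3) (Fin 3) E := Matrix.of fun k i => x (Fin.castSucc i) k with hBdef
  set B' : Matrix (Fin 3) (Fin 3) E := Matrix.of fun k i => x' (Fin.castSucc i) k with hB'def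
  have hB : IsUnit B := Matrix.linearIndependent_cols_iff_isUnit.mp hx
  have hB' : IsUnit B' := Matrix.linearIndependent_cols_iff_isUnit.mp hx'
  have hBd : IsUnit B.det := (Matrix.isUnit_iff_isUnit_det B).mp hB
  have hB'd : IsUnit B'.det := (Matrix.isUnit_iff_isUnit_det B').mp hB'
  -- the `3×3` Gram blocks agree
  have hGram : cstar c B * H * B = cstar c B' * H * B' := by
    ext i j
    rw [cstar_mul_mul_apply, cstar_mul_mul_apply]
    exact hG (Fin.castSucc i) (Fin.castSucc j)
  have hgB : B' * B⁻¹ * B = B' := by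
    rw [Matrix.mul_assoc, Matrix.nonsing_inv_mul B hBd, Matrix.mul_one]
  refine ⟨B' * B⁻¹, ?_, ?_⟩
  · -- unitarity of `g = B' B⁻¹`
    unfold IsUnitaryOf
    rw [cstar_mul]
    calc cstar c B⁻¹ * cstar c B' * H * (B' * B⁻¹)
        = cstar c B⁻¹ * (cstar c B' * H * B') * B⁻¹ := by simp only [Matrix.mul_assoc]
      _ = cstar c B⁻¹ * (cstar c B * H * B) * B⁻¹ := by rw [hGram]
      _ = (cstar c B⁻¹ * cstar c B) * H * (B * B⁻¹) := by simp only [Matrix.mul_assoc]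
      _ = cstar c (B * B⁻¹) * H * (B * B⁻¹) := by rw [cstar_mul]
      _ = H := by rw [Matrix.mul_nonsing_inv B hBd, cstar_one, Matrix.one_mul, Matrix.mul_one]
  · -- the four columns
    -- coordinates of the fourth vectors in the two bases
    obtain ⟨a, hxa⟩ : ∃ a : Fin 3 → E, B *ᵥ a = x (Fin.last 3) :=
      ⟨B⁻¹ *ᵥ x (Fin.last 3), by
        rw [Matrix.mulVec_mulVec, Matrix.mul_nonsing_inv B hBd, Matrix.one_mulVec]⟩
    obtain ⟨a', hx'a⟩ : ∃ a' : Fin 3 → E, B' *ᵥ a' = x' (Fin.last 3) :=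
      ⟨B'⁻¹ *ᵥ x' (Fin.last 3), by
        rw [Matrix.mulVec_mulVec, Matrix.mul_nonsing_inv B' hB'd, Matrix.one_mulVec]⟩
    -- the Gram columns `(⟨x_i, x₃⟩)_i = G a` and `(⟨x'_i, x'₃⟩)_i = G a'` agree
    have hGa : (cstar c B * H * B) *ᵥ a = (cstar c B * H * B) *ᵥ a' := by
      have h1 : (cstar c B * H * B) *ᵥ a = (cstar c B * H) *ᵥ x (Fin.last 3) := by
        rw [← Matrix.mulVec_mulVec, hxa]
      have h2 : (cstar c B' * H * B') *ᵥ a' = (cstar c B' * H) *ᵥ x' (Fin.last 3) := by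
        rw [← Matrix.mulVec_mulVec, hx'a]
      rw [h1, hGram, h2]
      funext i
      rw [cstar_mul_mulVec_apply, cstar_mul_mulVec_apply]
      exact hG (Fin.castSucc i) (Fin.last 3)
    have hGunit : IsUnit (cstar c B * H * B) :=
      ((isUnit_cstar c hB).mul (isUnit_of_anisotropic c H hAn)).mul hB
    have haa : a = a' := Matrix.mulVec_injective_iff_isUnit.mpr hGunit hGa
    intro j
    refine Fin.lastCases ?_ (fun i => ?_) j
    · -- the fourth vector
      rw [← hx'a, ← hxa, Matrix.mulVec_mulVec, hgB, haa]
    · -- the basis vectors: `g x_i` is the `i`-th column of `g B = B'`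
      funext l
      change x' (Fin.castSucc i) l = (B' * B⁻¹ * B) l i
      rw [hgB]
      rfl

/-- **L3.b in the skeleton's shape** (the hypothesis is the equality of the two Gram matrices
`fun i j => ⟨x_i, x_j⟩_H`, which is what `T4Data.gram x = T4Data.gram x'` of `Tier4/Line3/Skeleton.lean` unfolds to). -/
theorem witt_rank3_of_gram_eq (hAn : Anisotropic c H) (x x' : Fin 4 → Fin 3 → E)
    (hx : LinearIndependent E (fun j : Fin 3 => x (Fin.castSucc j)))
    (hx' : LinearIndependent E (fun j : Fin 3 => x' (Fin.castSucc j)))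
    (hG : (fun i j => hform c H (x i) (x j)) = fun i j => hform c H (x' i) (x' j)) :
    ∃ g : Matrix (Fin 3) (Fin 3) E, IsUnitaryOf c H g ∧ ∀ j, x' j = g *ᵥ x j :=
  witt_rank3_of_gram c H hAn x x' hx hx' fun i j => congrFun (congrFun hG i) j

end WittRank3

end Summit.Ventures.HodgeRepro.Tier4.Line3

end
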